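import Summits.HodgeConjecture.HodgeConjecture.Theses.CMComplexitySaturation

/-!
# Route `CMComplexitySaturation` — assembly item `Assembly` (stmt-HodgeConjecture-20100)

The assembly item records, as a statement, the implication decided by the route's deciding theorem
`Theses.CMComplexitySaturation.closes` (planner-authored, sorry-free, elaborating in the route file):
`CMAbelianHodge → MumfordTateFamily → BoundedStrataClosed → UniformCMComplexity → HodgeModels →
AbelianComplement → HodgeConjecture`.  The hypotheses of `closes` are exactly these six items in this
order, so the item is closed by the deciding theorem itself.  Nothing here is a case of the Hodge conjecture:
the two residuals `CMAbelianHodge` (HC for CM abelian varieties, stmt-HodgeConjecture-3052 — used BY NAME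
as a hypothesis, never restated) and `AbelianComplement`, and the three open cruxes, remain hypotheses.
No definition, no named-fact hypothesis, no sorry.
-/

set_option linter.dupNamespace false

noncomputable section

namespace Summit.HodgeConjecture.HodgeConjecture.Theorems

open Summit.HodgeConjecture.HodgeConjecture.Theses.CMComplexitySaturation in
/-- **Item stmt-HodgeConjecture-20100 (`Assembly`, route `CMComplexitySaturation`)**:
`CMAbelianHodge → MumfordTateFamily → BoundedStrataClosed → UniformCMComplexity → HodgeModels →
AbelianComplement → HodgeConjecture`, by the route's sorry-free deciding theorem `closes` (reduce to an
abelian variety `A`, put it in the Mumford–Tate family, transport HC(CM) to the dense CM fibres, bound the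
degree uniformly, close the bounded-degree stratum, read off algebraicity at `x₀`).  The type is literally
the route decl `Summit.HodgeConjecture.HodgeConjecture.Theses.CMComplexitySaturation.Assembly`.
[cite: Deligne1982HodgeCycles, §5 (Mumford–Tate families and CM points)] -/
theorem cmComplexitySaturation_assembly_proof :
    Summit.HodgeConjecture.HodgeConjecture.Theses.CMComplexitySaturation.Assembly := by
  unfold Summit.HodgeConjecture.HodgeConjecture.Theses.CMComplexitySaturation.Assembly
  exact fun hT hFam hCl hU hM hR ↦ closes hT hFam hCl hU hM hR

end Summit.HodgeConjecture.HodgeConjecture.Theorems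

end
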